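import Literature.Probability.Process.PointStationaryTransfer
import Literature.MathematicalPhysics.StatisticalMechanics.MuGSC
import Literature.MathematicalPhysics.StatisticalMechanics.LennardJonesClusters
import Summits.AtomisticToContinuum.Crystallization.Theorems.PalmUnimodularRigidityMinimiserShellsEnergyFloorC
import HarnessLib

/-!
# Crux `IsometryAtoms.MinimisingLawsHaveAtoms` (stmt-AtomisticToContinuum-15776), line `perron_transfer`:
# stub `stub_allSitesOfRoot` — everything shows at the root

Registered stub 2d of the bridge `stub_palmEnergyTransitive` of `Lines/perron_transfer.lean`: if a
point-stationary law `P` on rooted configurations of `ℝ³`, almost surely carried by rooted `δ`-hard-core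
configurations `μ = count|S` (`0 ∈ S`, `S` `δ`-separated), has root energy `h(μ) = ½ ∫ V_LJ(‖y‖) dμ ≤ e*`
almost surely (`e* = ⨅_Q e(Q)` the periodic ground-state energy per particle), then almost surely EVERY
site `p ∈ S` is `2e*`-bound: `Σ'_{q ∈ S, q ≠ p} V_LJ(dist p q) ≤ 2e*`.

Mechanism (all folklore):

* hard core ⇒ locally finite (`asr_count_restrict_floorNorm_lt_top`, packing
  `UniformlyDiscrete.finite_inter_closedBall`), so the Aldous–Lyons transfer
  `IsPointStationaryLaw.ae_forall_map_sub` ("everything shows at the root", [AldousLyons2007, Lemma 2.3])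
  moves the a.s. bound `h ≤ e*` from the root to the configuration re-rooted at every point `p ∈ S`,
  `θ_p (count|S) = count|(S - p)` (`map_sub_count_restrict`);
* the root energy of `count|(S - p)` is the site sum at `p` (`asr_tsum_sites_eq_two_mul_rootEnergy`):
  the Bochner integral against the counting measure of the countable set `S - p` is the `tsum`
  (`setIntegral_countable`; integrability from the energy-floor machinery
  `integrable_of_lintegral_ofReal_ne_top`), re-indexed through the translation `S ≃ S - p`
  (`tsum_image`), and the root's own term `V_LJ(0) = 0` is dropped (`tsum_eq_tsum_sdiff_singleton`).
-/

noncomputable section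

open MeasureTheory Set
open Literature.Probability.Process
open Literature.MathematicalPhysics.StatisticalMechanics (lennardJones lennardJones_zero rootEnergy
  rootEnergy_def UniformlyDiscrete UniformlyDiscrete.finite_inter_closedBall PeriodicConfiguration)
open Summit.AtomisticToContinuum.Crystallization.Theorems.MinimiserShells.Negative.Rootedness
  (countable_of_separated)
open Summit.AtomisticToContinuum.Crystallization.Theorems.PalmUnimodularRigidityMinimiserShells.EnergyFloor
  (measurable_lennardJones integrable_of_lintegral_ofReal_ne_top lintegral_pos_ne_top_of_hc
    lintegral_neg_le_of_hc)

namespace Summit.AtomisticToContinuum.Crystallization.Theorems.IsometryAtomsMinimisingLawsHaveAtoms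

/-- **Hard core ⇒ locally finite.** The counting measure of a `δ`-separated set (`δ > 0`) of `ℝ³`
gives finite mass to every norm shell `{⌊‖z‖⌋₊ = n} ⊆ B̄(0, n + 1)` (packing:
`UniformlyDiscrete.finite_inter_closedBall`). [folklore] -/
private theorem asr_count_restrict_floorNorm_lt_top {S : Set (EuclideanSpace ℝ (Fin 3))} {δ : ℝ}
    (hδ : 0 < δ) (hS : ∀ x ∈ S, ∀ y ∈ S, x ≠ y → δ ≤ dist x y) (n : ℕ) :
    (Measure.count : Measure (EuclideanSpace ℝ (Fin 3))).restrict S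
      ((fun z : EuclideanSpace ℝ (Fin 3) => ⌊‖z‖⌋₊) ⁻¹' {n}) < ⊤ := by
  rw [Measure.restrict_apply (measurableSet_floorNorm_preimage n)]
  refine (measure_mono ?_).trans_lt (Measure.count_apply_lt_top.2
    (UniformlyDiscrete.finite_inter_closedBall ⟨δ, hδ, hS⟩ (0 : EuclideanSpace ℝ (Fin 3))
      ((n : ℝ) + 1)))
  rintro z ⟨hz, hzS⟩
  exact ⟨hzS, floorNorm_preimage_subset_closedBall n hz⟩

/-- **Bochner integrals against `count|S` on a countable `S` are `tsum`s over `S`** (every singleton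
has count-mass one). [folklore] -/
private theorem asr_integral_count_restrict_eq_tsum {S : Set (EuclideanSpace ℝ (Fin 3))}
    (hSc : S.Countable) {f : EuclideanSpace ℝ (Fin 3) → ℝ}
    (hf : Integrable f ((Measure.count : Measure (EuclideanSpace ℝ (Fin 3))).restrict S)) :
    ∫ y, f y ∂((Measure.count : Measure (EuclideanSpace ℝ (Fin 3))).restrict S) =
      ∑' y : S, f y := by
  rw [setIntegral_countable f hSc hf]
  simp only [count_real_singleton, one_smul]

/-- **The site sum at `p` is twice the root energy of the configuration re-rooted at `p`.** For a
`δ`-separated `S ⊆ ℝ³` (`δ > 0`) and `p ∈ S`: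
`Σ'_{q ∈ S, q ≠ p} V_LJ(dist p q) = 2 · rootEnergy V_LJ (count|((· - p) '' S))` — the translate
`S - p ∋ 0` is `δ`-separated, so `y ↦ V_LJ(‖y‖)` is integrable against `count|(S - p)` and the
integral is the `tsum` over the countable set `S - p`, re-indexed by the translation and with the
vanishing root term `V_LJ(0) = 0` removed. [folklore] -/
private theorem asr_tsum_sites_eq_two_mul_rootEnergy {S : Set (EuclideanSpace ℝ (Fin 3))} {δ : ℝ}
    (hδ : 0 < δ) (hsep : ∀ x ∈ S, ∀ y ∈ S, x ≠ y → δ ≤ dist x y)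
    {p : EuclideanSpace ℝ (Fin 3)} (hp : p ∈ S) :
    ∑' q : {q : EuclideanSpace ℝ (Fin 3) // q ∈ S ∧ q ≠ p}, lennardJones (dist p q.1) =
      2 * rootEnergy lennardJones ((Measure.count : Measure (EuclideanSpace ℝ (Fin 3))).restrict
        ((fun z : EuclideanSpace ℝ (Fin 3) => z - p) '' S)) := by
  -- the translate `S - p` is a rooted `δ`-hard-core configuration, and countable
  have hsep' : ∀ x ∈ (fun z : EuclideanSpace ℝ (Fin 3) => z - p) '' S,
      ∀ y ∈ (fun z : EuclideanSpace ℝ (Fin 3) => z - p) '' S, x ≠ y → δ ≤ dist x y := by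
    rintro _ ⟨x, hx, rfl⟩ _ ⟨x', hx', rfl⟩ hne
    rw [dist_sub_right]
    exact hsep x hx x' hx' fun hxx' => hne (by rw [hxx'])
  have hhc : IsRootedHardCore δ ((Measure.count : Measure (EuclideanSpace ℝ (Fin 3))).restrict
      ((fun z : EuclideanSpace ℝ (Fin 3) => z - p) '' S)) :=
    ⟨(fun z : EuclideanSpace ℝ (Fin 3) => z - p) '' S, ⟨p, hp, sub_self p⟩, hsep', rfl⟩
  have hSc' : ((fun z : EuclideanSpace ℝ (Fin 3) => z - p) '' S).Countable :=
    countable_of_separated hδ hsep'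
  -- `y ↦ V_LJ(‖y‖)` is integrable against `count|(S - p)` (energy-floor machinery)
  have hint : Integrable (fun y : EuclideanSpace ℝ (Fin 3) => lennardJones ‖y‖)
      ((Measure.count : Measure (EuclideanSpace ℝ (Fin 3))).restrict
        ((fun z : EuclideanSpace ℝ (Fin 3) => z - p) '' S)) :=
    integrable_of_lintegral_ofReal_ne_top (measurable_lennardJones.comp measurable_norm)
      (lintegral_pos_ne_top_of_hc hδ hhc)
      (((lintegral_neg_le_of_hc hδ hhc).trans_lt ENNReal.ofReal_lt_top).ne)
  -- drop the vanishing root term `q = p`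
  have h1 : ∑' q : {q : EuclideanSpace ℝ (Fin 3) // q ∈ S ∧ q ≠ p}, lennardJones (dist p q.1) =
      ∑' q : S, lennardJones (dist p (q : EuclideanSpace ℝ (Fin 3))) := by
    have hpp : lennardJones (dist p p) = 0 := by rw [dist_self, lennardJones_zero]
    exact (tsum_eq_tsum_sdiff_singleton S (f := fun q => lennardJones (dist p q)) hpp).symm
  -- re-index through the translation `q ↦ q - p`
  have h2 : ∑' q : S, lennardJones (dist p (q : EuclideanSpace ℝ (Fin 3))) =
      ∑' y : (fun z : EuclideanSpace ℝ (Fin 3) => z - p) '' S,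
        lennardJones ‖(y : EuclideanSpace ℝ (Fin 3))‖ := by
    rw [tsum_image (fun y : EuclideanSpace ℝ (Fin 3) => lennardJones ‖y‖) sub_left_injective.injOn]
    refine tsum_congr fun q => ?_
    rw [dist_comm, dist_eq_norm]
  -- the integral against `count|(S - p)` is the `tsum`
  rw [h1, h2, rootEnergy_def, asr_integral_count_restrict_eq_tsum hSc' hint]
  ring

/-- **Stub 2d of line `perron_transfer` — everything shows at the root.** If a point-stationary law
`P` on rooted configurations of `ℝ³`, almost surely carried by rooted `δ`-hard-core configurations
(`δ > 0`), has root energy `h(μ) ≤ e*` almost surely, then almost surely the sample is `count|S` with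
`0 ∈ S`, `S` `δ`-separated, and EVERY site `p ∈ S` satisfies `Σ'_{q ∈ S, q ≠ p} V_LJ(dist p q) ≤ 2e*`:
hard core ⇒ locally finite, so the Aldous–Lyons transfer `IsPointStationaryLaw.ae_forall_map_sub`
gives `h(θ_p μ) ≤ e*` at every point `p` a.s.; `θ_p (count|S) = count|(S - p)`
(`map_sub_count_restrict`) and `2 h(count|(S - p))` is the site sum at `p`
(`asr_tsum_sites_eq_two_mul_rootEnergy`). [folklore; AldousLyons2007 §2, Lemma 2.3] -/
theorem stub_allSitesOfRoot : ∀ δ : ℝ, 0 < δ → ∀ P : MeasureTheory.Measure (MeasureTheory.Measure (EuclideanSpace ℝ (Fin 3))), (∀ᵐ μ ∂P, Literature.Probability.Process.IsRootedHardCore δ μ) → Literature.Probability.Process.IsPointStationaryLaw P → (∀ᵐ μ ∂P, Literature.MathematicalPhysics.StatisticalMechanics.rootEnergy Literature.MathematicalPhysics.StatisticalMechanics.lennardJones μ ≤ (⨅ Q : Literature.MathematicalPhysics.StatisticalMechanics.PeriodicConfiguration 3, Q.energyPerParticle Literature.MathematicalPhysics.StatisticalMechanics.lennardJones)) → ∀ᵐ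 μ ∂P, ∃ S : Set (EuclideanSpace ℝ (Fin 3)), (0 : EuclideanSpace ℝ (Fin 3)) ∈ S ∧ (∀ p ∈ S, ∀ q ∈ S, p ≠ q → δ ≤ dist p q) ∧ μ = (MeasureTheory.Measure.count : MeasureTheory.Measure (EuclideanSpace ℝ (Fin 3))).restrict S ∧ ∀ p ∈ S, ∑' q : {q : EuclideanSpace ℝ (Fin 3) // q ∈ S ∧ q ≠ p}, Literature.MathematicalPhysics.StatisticalMechanics.lennardJones (dist p q.1) ≤ 2 * ⨅ Q : Literature.MathematicalPhysics.StatisticalMechanics.PeriodicConfiguration 3, Q.energyPerParticle Literature.MathematicalPhysics.StatisticalMechanics.lennardJones := by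
  intro δ hδ P hhc hst hE
  -- hard-core configurations are locally finite
  have hlf : ∀ᵐ μ ∂P, ∀ n : ℕ, μ ((fun z : EuclideanSpace ℝ (Fin 3) => ⌊‖z‖⌋₊) ⁻¹' {n}) < ⊤ := by
    filter_upwards [hhc] with μ hμ n
    obtain ⟨S, -, hsep, rfl⟩ := hμ
    exact asr_count_restrict_floorNorm_lt_top hδ hsep n
  -- everything shows at the root: `h(θ_y μ) ≤ e*` at every point `y` of `μ`, a.s.
  have hall := hst.ae_forall_map_sub hlf hE
  filter_upwards [hhc, hall] with μ hμ hallμ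
  obtain ⟨S, h0, hsep, rfl⟩ := hμ
  refine ⟨S, h0, hsep, rfl, fun p hp => ?_⟩
  have hroot := hallμ p ((count_restrict_singleton_ne_zero_iff S p).2 hp)
  rw [map_sub_count_restrict S p] at hroot
  rw [asr_tsum_sites_eq_two_mul_rootEnergy hδ hsep hp]
  linarith

end Summit.AtomisticToContinuum.Crystallization.Theorems.IsometryAtomsMinimisingLawsHaveAtoms

end
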